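import Summits.QuantumFields.YangMills.Theorems.AllWindowsColdBoxBoxHighLineWickPairCubicChart
import Summits.QuantumFields.YangMills.Theorems.AllWindowsColdBoxBoxHighLineColourDiagContraction

/-!
# `ConnectedThreePoint`, ODD part: the centred colour-diagonal RANK-ONE quadratic form (`linCurvSq_T − E₀linCurvSq_T`) against two colour-distinct cubic
# monomials — the two pair legs become GRADIENT lines `(wG)`; abstract size `≤ 36·D_max·W²` (U5-BLOCKERS §2, lift L2 / ASSEMBLY-U5 §3)

Width seat `ym-line-sfw-p2-w3` (g41), cell ym-idea-1; U5 prep, helper-grade.  Third file of the odd part (✓`…WickPairCubicCubic` process level, ⧗`…WickPairCubicChart`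
monomial form in the chart).  Summing the pair `(b,b')` against `L_{bb'} = [κ_b = κ_{b'}]·w(e_b)w(e_{b'})` (the Gaussian part `linCurvSq` of a plaquette cost has
`w = landauCoeff`, ✓`Cum3Triangle.linCurvSq_eq_quadVal`) turns the two pair propagators `S(b,i)S(b',i')` of every surviving pairing into
`D(i,i') = (2β)⁻²·[κ_i = κ_{i'}]·(w ᵥ* g)(e_i)·(w ᵥ* g)(e_{i'})` — two GRADIENT lines (✓H4b.1′ decay `(1+d)⁻³`) from the plaquette of `w` into the two monomials:

* `WickPairCubic.integral_centredQuadForm_mul_three_mul_three` (process level) and ★ `gauss_centredForm_mul_three_mul_three` (chart, any coefficient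
  matrix `L`): `E₀[(Σ_{bb'} L_{bb'}(v_bv_{b'} − S_{bb'}))·v_{l₀}v_{l₁}v_{l₂}·v_{m₀}v_{m₁}v_{m₂}] = Σ_{bb'} L_{bb'}·(36 connected pairings)`;
* `ColourDiag.sum_rankOne_mul_mul` — `Σ_{bb'} L_{bb'}·S(b,i)·S(b',i') = (2β)⁻¹^2·[i.2 = i'.2]·(w ᵥ* g) i.1·(w ᵥ* g) i'.1` for colour-diagonal rank-one `L` and
  `S = (2β)⁻¹·(g ⊗ 1)`;
* ★★ `gauss_centredRankOne_mul_three_mul_three` — hence `E₀[L̃_w·mono_l·mono_m] = Σ_{i∈l, i'∈m} 2·D(l_i,m_{i'})·(the two bipartite pairings of the other four in S)`;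
* ★ `abs_nineBlocks_le` — `|Σ_{i,i'} 2·D(l_i,m_{i'})·(S·S + S·S)| ≤ 36·D_max·W²` under `|D(l_i,m_{i'})| ≤ D_max`, `|S(l_i,m_{j})| ≤ W`.
Cold box: `g = (hodgeQ H)⁻¹`, `w = landauCoeff H p_T`, monomials from ✓`tripleForm_plaqVar_expansion` on the edges of `p₀` and `p'`: `D_max ≲ β⁻²(1+log H)²(1+d(T,p₀))⁻³(1+d(T,p'))⁻³`,
`W ≲ β⁻¹(1+log H)(1+d(p₀,p'))⁻²` (✓`RestBlock.landauKernelGradDecay`, ✓S3b); the `p'`-sum and the expansion coefficients are the assembler's (✓`EdgeSums.edgeTwoCentreSums`).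

Tree + Mathlib only; no definitions; standard axioms.  HONEST LABEL: a tool for the RECORDED lift L2 of the NEXT rung U5 (⟨stmt-QuantumFields-24336⟩, UNSTAFFED);
⟨24004⟩ ⟨24336⟩ remain OPEN; route AllWindowsColdBox is DRAFT; no crux, rung or summit is proved; **the Yang–Mills mass gap is NOT proved by this file; no summit
is proved by a line.**
-/

set_option autoImplicit false

noncomputable section

open MeasureTheory ProbabilityTheory Matrix Finset
open scoped Kronecker
open Literature.Probability.Distributions.GaussianWick
open Summit.QuantumFields.YangMills.Theorems.AllWindowsColdBox.CubicChaos (integrable_mul_six)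

namespace Summit.QuantumFields.YangMills.Theorems.AllWindowsColdBoxBoxHighLine

namespace WickPairCubic

variable {T Ω : Type*} {mΩ : MeasurableSpace Ω} {P : Measure Ω} {X : T → Ω → ℝ}

/-- The centred pair against two monomials is integrable. -/
theorem integrable_wick2_mul_three_mul_three (hX : IsGaussianProcess X P) (c : ℝ) (b b' l₀ l₁ l₂ m₀ m₁ m₂ : T) :
    Integrable (fun ω => (X b ω * X b' ω - c) * (X l₀ ω * X l₁ ω * X l₂ ω) * (X m₀ ω * X m₁ ω * X m₂ ω)) P := by
  have h8 := integrable_mul_eight hX b b' l₀ l₁ l₂ m₀ m₁ m₂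
  have h6 := (integrable_mul_six hX l₀ l₁ l₂ m₀ m₁ m₂).const_mul c
  refine (h8.sub h6).congr (ae_of_all _ fun ω => ?_)
  simp only [Pi.sub_apply]
  ring

/-- **A centred quadratic form against two monomials with no intra-monomial line** (process level). -/
theorem integral_centredQuadForm_mul_three_mul_three (hX : IsGaussianProcess X P) (h0 : ∀ s, ∫ ω, X s ω ∂P = 0)
    {κ : Type*} [Fintype κ] (t : κ → T) (C : T → T → ℝ) (hC : ∀ s s', C s s' = ∫ ω, X s ω * X s' ω ∂P) (L : κ → κ → ℝ)
    (l₀ l₁ l₂ m₀ m₁ m₂ : κ) (h01 : C (t l₀) (t l₁) = 0) (h02 : C (t l₀) (t l₂) = 0) (h12 : C (t l₁) (t l₂) = 0)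
    (h01' : C (t m₀) (t m₁) = 0) (h02' : C (t m₀) (t m₂) = 0) (h12' : C (t m₁) (t m₂) = 0) {QL : Ω → ℝ}
    (hQL : ∀ ω, QL ω = ∑ b, ∑ b', L b b' * (X (t b) ω * X (t b') ω - C (t b) (t b'))) :
    ∫ ω, QL ω * (X (t l₀) ω * X (t l₁) ω * X (t l₂) ω) * (X (t m₀) ω * X (t m₁) ω * X (t m₂) ω) ∂P =
      ∑ b, ∑ b', L b b' *
          ((C (t b) (t l₀) * C (t b') (t m₀) + C (t b) (t m₀) * C (t b') (t l₀)) * (C (t l₁) (t m₁) * C (t l₂) (t m₂) + C (t l₁) (t m₂) * C (t l₂) (t m₁)) +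
           (C (t b) (t l₀) * C (t b') (t m₁) + C (t b) (t m₁) * C (t b') (t l₀)) * (C (t l₁) (t m₀) * C (t l₂) (t m₂) + C (t l₁) (t m₂) * C (t l₂) (t m₀)) +
           (C (t b) (t l₀) * C (t b') (t m₂) + C (t b) (t m₂) * C (t b') (t l₀)) * (C (t l₁) (t m₀) * C (t l₂) (t m₁) + C (t l₁) (t m₁) * C (t l₂) (t m₀)) +
           (C (t b) (t l₁) * C (t b') (t m₀) + C (t b) (t m₀) * C (t b') (t l₁)) * (C (t l₀) (t m₁) * C (t l₂) (t m₂) + C (t l₀) (t m₂) * C (t l₂) (t m₁)) +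
           (C (t b) (t l₁) * C (t b') (t m₁) + C (t b) (t m₁) * C (t b') (t l₁)) * (C (t l₀) (t m₀) * C (t l₂) (t m₂) + C (t l₀) (t m₂) * C (t l₂) (t m₀)) +
           (C (t b) (t l₁) * C (t b') (t m₂) + C (t b) (t m₂) * C (t b') (t l₁)) * (C (t l₀) (t m₀) * C (t l₂) (t m₁) + C (t l₀) (t m₁) * C (t l₂) (t m₀)) +
           (C (t b) (t l₂) * C (t b') (t m₀) + C (t b) (t m₀) * C (t b') (t l₂)) * (C (t l₀) (t m₁) * C (t l₁) (t m₂) + C (t l₀) (t m₂) * C (t l₁) (t m₁)) +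
           (C (t b) (t l₂) * C (t b') (t m₁) + C (t b) (t m₁) * C (t b') (t l₂)) * (C (t l₀) (t m₀) * C (t l₁) (t m₂) + C (t l₀) (t m₂) * C (t l₁) (t m₀)) +
           (C (t b) (t l₂) * C (t b') (t m₂) + C (t b) (t m₂) * C (t b') (t l₂)) * (C (t l₀) (t m₀) * C (t l₁) (t m₁) + C (t l₀) (t m₁) * C (t l₁) (t m₀))) := by
  classical
  have hsum : ∀ ω, QL ω * (X (t l₀) ω * X (t l₁) ω * X (t l₂) ω) * (X (t m₀) ω * X (t m₁) ω * X (t m₂) ω) =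
      ∑ b, ∑ b', L b b' * ((X (t b) ω * X (t b') ω - C (t b) (t b')) * (X (t l₀) ω * X (t l₁) ω * X (t l₂) ω) *
        (X (t m₀) ω * X (t m₁) ω * X (t m₂) ω)) := by
    intro ω
    rw [hQL ω, Finset.sum_mul, Finset.sum_mul]
    refine Finset.sum_congr rfl fun b _ => ?_
    rw [Finset.sum_mul, Finset.sum_mul]
    exact Finset.sum_congr rfl fun b' _ => by ring
  simp_rw [hsum]
  rw [integral_finsetSum _ fun b _ => integrable_finsetSum _ fun b' _ =>
    (integrable_wick2_mul_three_mul_three hX _ _ _ _ _ _ _ _ _).const_mul _]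
  refine Finset.sum_congr rfl fun b _ => ?_
  rw [integral_finsetSum _ fun b' _ => (integrable_wick2_mul_three_mul_three hX _ _ _ _ _ _ _ _ _).const_mul _]
  refine Finset.sum_congr rfl fun b' _ => ?_
  rw [integral_const_mul, integral_wick2_mul_three_mul_three hX h0 C hC _ _ _ _ _ _ _ _ h01 h02 h12 h01' h02' h12']

end WickPairCubic

open GaussianChartWick

/-! ## In the chart: the centred form `Σ L_{bb'}(v_bv_{b'} − S_{bb'})` against two monomials -/

section Chart

variable {ι : Type*} [Fintype ι] [DecidableEq ι]

/-- ★ **A centred quadratic form against two monomials with no intra-monomial propagator, in the chart** (`S = (2β)⁻¹P⁻¹` is the covariance,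
so `Σ_{bb'} L_{bb'}(v_bv_{b'} − S_{bb'})` is the centred form). -/
theorem gauss_centredForm_mul_three_mul_three (P : Matrix ι ι ℝ) (hP : P.PosDef) {β : ℝ} (hβ : 0 < β) (S : ι → ι → ℝ)
    (hS : ∀ i j, S i j = (2 * β)⁻¹ * P⁻¹ i j) (L : ι → ι → ℝ) (l₀ l₁ l₂ m₀ m₁ m₂ : ι)
    (h01 : S l₀ l₁ = 0) (h02 : S l₀ l₂ = 0) (h12 : S l₁ l₂ = 0) (h01' : S m₀ m₁ = 0) (h02' : S m₀ m₂ = 0) (h12' : S m₁ m₂ = 0) :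
    (∫ v : ι → ℝ, (∑ b, ∑ b', L b b' * (v b * v b' - S b b')) * (v l₀ * v l₁ * v l₂) * (v m₀ * v m₁ * v m₂) *
        Real.exp (-(β * (v ⬝ᵥ P *ᵥ v)))) / (∫ v : ι → ℝ, Real.exp (-(β * (v ⬝ᵥ P *ᵥ v)))) =
      ∑ b, ∑ b', L b b' *
          ((S b l₀ * S b' m₀ + S b m₀ * S b' l₀) * (S l₁ m₁ * S l₂ m₂ + S l₁ m₂ * S l₂ m₁) +
           (S b l₀ * S b' m₁ + S b m₁ * S b' l₀) * (S l₁ m₀ * S l₂ m₂ + S l₁ m₂ * S l₂ m₀) +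
           (S b l₀ * S b' m₂ + S b m₂ * S b' l₀) * (S l₁ m₀ * S l₂ m₁ + S l₁ m₁ * S l₂ m₀) +
           (S b l₁ * S b' m₀ + S b m₀ * S b' l₁) * (S l₀ m₁ * S l₂ m₂ + S l₀ m₂ * S l₂ m₁) +
           (S b l₁ * S b' m₁ + S b m₁ * S b' l₁) * (S l₀ m₀ * S l₂ m₂ + S l₀ m₂ * S l₂ m₀) +
           (S b l₁ * S b' m₂ + S b m₂ * S b' l₁) * (S l₀ m₀ * S l₂ m₁ + S l₀ m₁ * S l₂ m₀) +
           (S b l₂ * S b' m₀ + S b m₀ * S b' l₂) * (S l₀ m₁ * S l₁ m₂ + S l₀ m₂ * S l₁ m₁) +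
           (S b l₂ * S b' m₁ + S b m₁ * S b' l₂) * (S l₀ m₀ * S l₁ m₂ + S l₀ m₂ * S l₁ m₀) +
           (S b l₂ * S b' m₂ + S b m₂ * S b' l₂) * (S l₀ m₀ * S l₁ m₁ + S l₀ m₁ * S l₁ m₀)) := by
  obtain ⟨R, hRP, hR, htr⟩ := integral_mul_exp_quadForm_eq_integral_legs P hP hβ
  set e := Fintype.equivFin ι with he
  set μ : Measure (Fin (Fintype.card ι) → ℝ) :=
    Measure.pi (fun _ : Fin (Fintype.card ι) => gaussianReal 0 (Real.toNNReal (2 * β)⁻¹)) with hμ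
  set Z : ℝ := Real.sqrt (Real.pi / β) ^ Fintype.card ι / |R.det| with hZ
  have hZpos : 0 < Z := div_pos (pow_pos (Real.sqrt_pos.mpr (div_pos Real.pi_pos hβ)) _) (abs_pos.mpr hR)
  set X : (Fin (Fintype.card ι) → ℝ) → (Fin (Fintype.card ι) → ℝ) → ℝ := fun ℓ u => ℓ ⬝ᵥ (R⁻¹ *ᵥ u) with hX
  have hGP : IsGaussianProcess X μ := isGaussianProcess_legs R β
  have h0 : ∀ ℓ, ∫ u, X ℓ u ∂μ = 0 := integral_leg_eq_zero R β
  set t : ι → (Fin (Fintype.card ι) → ℝ) := fun i => Pi.single (e i) (1 : ℝ) with ht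
  set φ : (Fin (Fintype.card ι) → ℝ) → (ι → ℝ) := fun u i => (R⁻¹ *ᵥ u) (e i) with hφ
  have hXt : ∀ i u, X (t i) u = φ u i := fun i u => by simp only [hX, ht, hφ, single_one_dotProduct]
  set C : (Fin (Fintype.card ι) → ℝ) → (Fin (Fintype.card ι) → ℝ) → ℝ := fun s s' => ∫ u, X s u * X s' u ∂μ with hC
  have hCS : ∀ i j, C (t i) (t j) = S i j := fun i j => by rw [hS]; exact two_point_legs P hβ hRP i j
  have hnorm : ∫ v : ι → ℝ, Real.exp (-(β * (v ⬝ᵥ P *ᵥ v))) = Z := by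
    have h := htr (fun _ => 1)
    simp only [one_mul] at h
    rw [h, integral_const, smul_eq_mul, probReal_univ, one_mul, mul_one]
  have hE : ∀ F : (ι → ℝ) → ℝ, (∫ v : ι → ℝ, F v * Real.exp (-(β * (v ⬝ᵥ P *ᵥ v)))) /
      (∫ v : ι → ℝ, Real.exp (-(β * (v ⬝ᵥ P *ᵥ v)))) = ∫ u, F (φ u) ∂μ := fun F => by
    rw [hnorm, htr F, mul_div_cancel_left₀ _ hZpos.ne']
  rw [hE (fun v => (∑ b, ∑ b', L b b' * (v b * v b' - S b b')) * (v l₀ * v l₁ * v l₂) * (v m₀ * v m₁ * v m₂))]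
  have key := WickPairCubic.integral_centredQuadForm_mul_three_mul_three hGP h0 t C (fun _ _ => rfl) L l₀ l₁ l₂ m₀ m₁ m₂
    (by rw [hCS]; exact h01) (by rw [hCS]; exact h02) (by rw [hCS]; exact h12) (by rw [hCS]; exact h01') (by rw [hCS]; exact h02')
    (by rw [hCS]; exact h12') (QL := fun u => ∑ b, ∑ b', L b b' * (φ u b * φ u b' - S b b'))
    (fun u => by simp only [hXt, hCS])
  simp only [hXt] at key
  rw [key]
  simp only [hCS]

end Chart

/-! ## The rank-one collapse of the pair: two gradient lines -/

namespace ColourDiag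

variable {E : Type*} [Fintype E]

/-- **Rank-one collapse**: for `L (e,κ) (e',κ') = [κ=κ']·w e·w e'` and `S (e,κ) (e',κ') = s·[κ=κ']·g e e'`,
`Σ_{bb'} L_{bb'}·S(b,i)·S(b',i') = s²·[κ_i = κ_{i'}]·(w ᵥ* g)(e_i)·(w ᵥ* g)(e_{i'})`. -/
theorem sum_rankOne_mul_mul (w : E → ℝ) (g : Matrix E E ℝ) (s : ℝ) {L S : Matrix (E × Fin 3) (E × Fin 3) ℝ}
    (hL : ∀ i j, L i j = if i.2 = j.2 then w i.1 * w j.1 else 0) (hS : ∀ i j, S i j = s * if i.2 = j.2 then g i.1 j.1 else 0)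
    (i i' : E × Fin 3) :
    (∑ b, ∑ b', L b b' * (S b i * S b' i')) = s ^ 2 * if i.2 = i'.2 then (w ᵥ* g) i.1 * (w ᵥ* g) i'.1 else 0 := by
  -- as a matrix entry `(Sᵀ * (L * S)) i i'`
  have e1 : (∑ b, ∑ b', L b b' * (S b i * S b' i')) = (Sᵀ * (L * S)) i i' := by
    simp only [Matrix.mul_apply, Matrix.transpose_apply, Finset.mul_sum]
    exact Finset.sum_congr rfl fun b _ => Finset.sum_congr rfl fun b' _ => by ring
  have hSt : ∀ p q : E × Fin 3, Sᵀ p q = if p.2 = q.2 then (fun e e' => s * g e' e) p.1 q.1 else 0 := by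
    intro p q
    rw [Matrix.transpose_apply, hS]
    by_cases h : p.2 = q.2
    · rw [if_pos h, if_pos h.symm]
    · rw [if_neg h, if_neg (Ne.symm h), mul_zero]
  have hL' : ∀ p q : E × Fin 3, L p q = if p.2 = q.2 then (fun e e' => w e * w e') p.1 q.1 else 0 := hL
  rw [e1, colourDiag_mul_apply (x := fun e e' => s * g e' e) hSt]
  simp only [colourDiag_mul_apply (x := fun e e' => w e * w e') hL', hS]
  rcases eq_or_ne i.2 i'.2 with h | h
  · simp only [h, if_true, Matrix.vecMul, dotProduct]
    rw [Finset.sum_mul_sum, Finset.mul_sum]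
    refine Finset.sum_congr rfl fun e _ => ?_
    rw [Finset.mul_sum, Finset.mul_sum]
    exact Finset.sum_congr rfl fun e' _ => by ring
  · simp only [h, if_false, mul_zero, Finset.sum_const_zero]

end ColourDiag

/-! ## The centred rank-one form against two monomials: gradient lines, and the abstract size -/

section RankOne

variable {E : Type*} [Fintype E] [DecidableEq E]

/-- ★★ **The centred colour-diagonal rank-one form against two colour-distinct monomials, in the chart**: with `g = P⁻¹`-kernel on `E`,
`S = (2β)⁻¹·(g ⊗ 1)`, `D(i,i') = (2β)⁻¹^2·[κ_i=κ_{i'}]·(w ᵥ* g)(e_i)(w ᵥ* g)(e_{i'})`: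
`E₀[(Σ_{bb'} L_{bb'}(v_bv_{b'} − S_{bb'}))·mono_l·mono_m] = Σ_{i∈l,i'∈m} 2·D(l_i,m_{i'})·(two bipartite pairings of the rest)`. -/
theorem gauss_centredRankOne_mul_three_mul_three (Pm : Matrix (E × Fin 3) (E × Fin 3) ℝ) (hP : Pm.PosDef) {β : ℝ} (hβ : 0 < β)
    (g : Matrix E E ℝ) (w : E → ℝ) (S D L : (E × Fin 3) → (E × Fin 3) → ℝ) (hSP : ∀ i j, S i j = (2 * β)⁻¹ * Pm⁻¹ i j)
    (hS : ∀ i j, S i j = (2 * β)⁻¹ * if i.2 = j.2 then g i.1 j.1 else 0)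
    (hD : ∀ i j, D i j = (2 * β)⁻¹ ^ 2 * if i.2 = j.2 then (w ᵥ* g) i.1 * (w ᵥ* g) j.1 else 0)
    (hL : ∀ i j, L i j = if i.2 = j.2 then w i.1 * w j.1 else 0) (l₀ l₁ l₂ m₀ m₁ m₂ : E × Fin 3)
    (h01 : l₀.2 ≠ l₁.2) (h02 : l₀.2 ≠ l₂.2) (h12 : l₁.2 ≠ l₂.2) (h01' : m₀.2 ≠ m₁.2) (h02' : m₀.2 ≠ m₂.2) (h12' : m₁.2 ≠ m₂.2) :
    (∫ v : E × Fin 3 → ℝ, (∑ b, ∑ b', L b b' * (v b * v b' - S b b')) * (v l₀ * v l₁ * v l₂) * (v m₀ * v m₁ * v m₂) *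
        Real.exp (-(β * (v ⬝ᵥ Pm *ᵥ v)))) / (∫ v : E × Fin 3 → ℝ, Real.exp (-(β * (v ⬝ᵥ Pm *ᵥ v)))) =
      2 * D l₀ m₀ * (S l₁ m₁ * S l₂ m₂ + S l₁ m₂ * S l₂ m₁) +
        2 * D l₀ m₁ * (S l₁ m₀ * S l₂ m₂ + S l₁ m₂ * S l₂ m₀) +
        2 * D l₀ m₂ * (S l₁ m₀ * S l₂ m₁ + S l₁ m₁ * S l₂ m₀) +
        2 * D l₁ m₀ * (S l₀ m₁ * S l₂ m₂ + S l₀ m₂ * S l₂ m₁) +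
        2 * D l₁ m₁ * (S l₀ m₀ * S l₂ m₂ + S l₀ m₂ * S l₂ m₀) +
        2 * D l₁ m₂ * (S l₀ m₀ * S l₂ m₁ + S l₀ m₁ * S l₂ m₀) +
        2 * D l₂ m₀ * (S l₀ m₁ * S l₁ m₂ + S l₀ m₂ * S l₁ m₁) +
        2 * D l₂ m₁ * (S l₀ m₀ * S l₁ m₂ + S l₀ m₂ * S l₁ m₀) +
        2 * D l₂ m₂ * (S l₀ m₀ * S l₁ m₁ + S l₀ m₁ * S l₁ m₀) := by
  have hzero : ∀ i j : E × Fin 3, i.2 ≠ j.2 → S i j = 0 := fun i j hij => by rw [hS, if_neg hij, mul_zero]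
  rw [gauss_centredForm_mul_three_mul_three Pm hP hβ S hSP L l₀ l₁ l₂ m₀ m₁ m₂ (hzero _ _ h01) (hzero _ _ h02) (hzero _ _ h12)
    (hzero _ _ h01') (hzero _ _ h02') (hzero _ _ h12')]
  have hDD : ∀ i i', (∑ b, ∑ b', L b b' * (S b i * S b' i' + S b i' * S b' i)) = 2 * D i i' := by
    intro i i'
    have h1 : (∑ b, ∑ b', L b b' * (S b i * S b' i' + S b i' * S b' i)) =
        (∑ b, ∑ b', L b b' * (S b i * S b' i')) + ∑ b, ∑ b', L b b' * (S b i' * S b' i) := by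
      rw [← Finset.sum_add_distrib]
      exact Finset.sum_congr rfl fun b _ => by rw [← Finset.sum_add_distrib]; exact Finset.sum_congr rfl fun b' _ => by ring
    rw [h1, ColourDiag.sum_rankOne_mul_mul w g _ hL hS, ColourDiag.sum_rankOne_mul_mul w g _ hL hS, hD]
    rcases eq_or_ne i.2 i'.2 with h | h
    · have h' : i'.2 = i.2 := h.symm
      simp only [h', if_true]; ring
    · have h' : i'.2 ≠ i.2 := Ne.symm h
      simp only [h, h', if_false]; ring
  -- distribute `L` over the nine blocks and collapse each pair of pair-propagators
  have hsplit : ∀ b b' : E × Fin 3, L b b' *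
        ((S b l₀ * S b' m₀ + S b m₀ * S b' l₀) * (S l₁ m₁ * S l₂ m₂ + S l₁ m₂ * S l₂ m₁) +
          (S b l₀ * S b' m₁ + S b m₁ * S b' l₀) * (S l₁ m₀ * S l₂ m₂ + S l₁ m₂ * S l₂ m₀) +
          (S b l₀ * S b' m₂ + S b m₂ * S b' l₀) * (S l₁ m₀ * S l₂ m₁ + S l₁ m₁ * S l₂ m₀) +
          (S b l₁ * S b' m₀ + S b m₀ * S b' l₁) * (S l₀ m₁ * S l₂ m₂ + S l₀ m₂ * S l₂ m₁) +
          (S b l₁ * S b' m₁ + S b m₁ * S b' l₁) * (S l₀ m₀ * S l₂ m₂ + S l₀ m₂ * S l₂ m₀) +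
          (S b l₁ * S b' m₂ + S b m₂ * S b' l₁) * (S l₀ m₀ * S l₂ m₁ + S l₀ m₁ * S l₂ m₀) +
          (S b l₂ * S b' m₀ + S b m₀ * S b' l₂) * (S l₀ m₁ * S l₁ m₂ + S l₀ m₂ * S l₁ m₁) +
          (S b l₂ * S b' m₁ + S b m₁ * S b' l₂) * (S l₀ m₀ * S l₁ m₂ + S l₀ m₂ * S l₁ m₀) +
          (S b l₂ * S b' m₂ + S b m₂ * S b' l₂) * (S l₀ m₀ * S l₁ m₁ + S l₀ m₁ * S l₁ m₀)) =
      L b b' * (S b l₀ * S b' m₀ + S b m₀ * S b' l₀) * (S l₁ m₁ * S l₂ m₂ + S l₁ m₂ * S l₂ m₁) +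
      L b b' * (S b l₀ * S b' m₁ + S b m₁ * S b' l₀) * (S l₁ m₀ * S l₂ m₂ + S l₁ m₂ * S l₂ m₀) +
      L b b' * (S b l₀ * S b' m₂ + S b m₂ * S b' l₀) * (S l₁ m₀ * S l₂ m₁ + S l₁ m₁ * S l₂ m₀) +
      L b b' * (S b l₁ * S b' m₀ + S b m₀ * S b' l₁) * (S l₀ m₁ * S l₂ m₂ + S l₀ m₂ * S l₂ m₁) +
      L b b' * (S b l₁ * S b' m₁ + S b m₁ * S b' l₁) * (S l₀ m₀ * S l₂ m₂ + S l₀ m₂ * S l₂ m₀) +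
      L b b' * (S b l₁ * S b' m₂ + S b m₂ * S b' l₁) * (S l₀ m₀ * S l₂ m₁ + S l₀ m₁ * S l₂ m₀) +
      L b b' * (S b l₂ * S b' m₀ + S b m₀ * S b' l₂) * (S l₀ m₁ * S l₁ m₂ + S l₀ m₂ * S l₁ m₁) +
      L b b' * (S b l₂ * S b' m₁ + S b m₁ * S b' l₂) * (S l₀ m₀ * S l₁ m₂ + S l₀ m₂ * S l₁ m₀) +
      L b b' * (S b l₂ * S b' m₂ + S b m₂ * S b' l₂) * (S l₀ m₀ * S l₁ m₁ + S l₀ m₁ * S l₁ m₀) := fun b b' => by ring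
  simp only [hsplit, Finset.sum_add_distrib, ← Finset.sum_mul, hDD]

omit [Fintype E] [DecidableEq E] in
/-- ★ **Abstract size of the nine blocks**: `|Σ_{i,i'} 2·D(l_i,m_{i'})·(S·S + S·S)| ≤ 36·D_max·W²`. -/
theorem abs_nineBlocks_le (S D : (E × Fin 3) → (E × Fin 3) → ℝ) (l₀ l₁ l₂ m₀ m₁ m₂ : E × Fin 3) {Dm W : ℝ}
    (hD : ∀ i j : Fin 3, |D (![l₀, l₁, l₂] i) (![m₀, m₁, m₂] j)| ≤ Dm) (hW : ∀ i j : Fin 3, |S (![l₀, l₁, l₂] i) (![m₀, m₁, m₂] j)| ≤ W) :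
    |2 * D l₀ m₀ * (S l₁ m₁ * S l₂ m₂ + S l₁ m₂ * S l₂ m₁) +
        2 * D l₀ m₁ * (S l₁ m₀ * S l₂ m₂ + S l₁ m₂ * S l₂ m₀) +
        2 * D l₀ m₂ * (S l₁ m₀ * S l₂ m₁ + S l₁ m₁ * S l₂ m₀) +
        2 * D l₁ m₀ * (S l₀ m₁ * S l₂ m₂ + S l₀ m₂ * S l₂ m₁) +
        2 * D l₁ m₁ * (S l₀ m₀ * S l₂ m₂ + S l₀ m₂ * S l₂ m₀) +
        2 * D l₁ m₂ * (S l₀ m₀ * S l₂ m₁ + S l₀ m₁ * S l₂ m₀) +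
        2 * D l₂ m₀ * (S l₀ m₁ * S l₁ m₂ + S l₀ m₂ * S l₁ m₁) +
        2 * D l₂ m₁ * (S l₀ m₀ * S l₁ m₂ + S l₀ m₂ * S l₁ m₀) +
        2 * D l₂ m₂ * (S l₀ m₀ * S l₁ m₁ + S l₀ m₁ * S l₁ m₀)| ≤ 36 * Dm * W ^ 2 := by
  have hDm : 0 ≤ Dm := (abs_nonneg _).trans (hD 0 0)
  have hW0 : 0 ≤ W := (abs_nonneg _).trans (hW 0 0)
  -- every block is at most `4·Dm·W²`
  have hblock : ∀ (i j p p' q q' : Fin 3),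
      |2 * D (![l₀, l₁, l₂] i) (![m₀, m₁, m₂] j) * (S (![l₀, l₁, l₂] p) (![m₀, m₁, m₂] p') * S (![l₀, l₁, l₂] q) (![m₀, m₁, m₂] q') +
        S (![l₀, l₁, l₂] p) (![m₀, m₁, m₂] q') * S (![l₀, l₁, l₂] q) (![m₀, m₁, m₂] p'))| ≤ 4 * Dm * W ^ 2 := by
    intro i j p p' q q'
    rw [abs_mul, abs_mul, abs_two]
    have h1 : |S (![l₀, l₁, l₂] p) (![m₀, m₁, m₂] p') * S (![l₀, l₁, l₂] q) (![m₀, m₁, m₂] q') +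
        S (![l₀, l₁, l₂] p) (![m₀, m₁, m₂] q') * S (![l₀, l₁, l₂] q) (![m₀, m₁, m₂] p')| ≤ W * W + W * W := by
      refine (abs_add_le _ _).trans (add_le_add ?_ ?_) <;> rw [abs_mul] <;>
        exact mul_le_mul (hW _ _) (hW _ _) (abs_nonneg _) hW0
    calc 2 * |D (![l₀, l₁, l₂] i) (![m₀, m₁, m₂] j)| * _ ≤ 2 * Dm * (W * W + W * W) :=
          mul_le_mul (mul_le_mul_of_nonneg_left (hD i j) (by norm_num)) h1 (abs_nonneg _) (by positivity)
      _ = 4 * Dm * W ^ 2 := by ring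
  have b00 := hblock 0 0 1 1 2 2
  have b01 := hblock 0 1 1 0 2 2
  have b02 := hblock 0 2 1 0 2 1
  have b10 := hblock 1 0 0 1 2 2
  have b11 := hblock 1 1 0 0 2 2
  have b12 := hblock 1 2 0 0 2 1
  have b20 := hblock 2 0 0 1 1 2
  have b21 := hblock 2 1 0 0 1 2
  have b22 := hblock 2 2 0 0 1 1
  simp only [Matrix.cons_val_zero, Matrix.cons_val_one, Matrix.cons_val] at b00 b01 b02 b10 b11 b12 b20 b21 b22
  calc _ ≤ 4 * Dm * W ^ 2 + 4 * Dm * W ^ 2 + 4 * Dm * W ^ 2 + 4 * Dm * W ^ 2 + 4 * Dm * W ^ 2 + 4 * Dm * W ^ 2 +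
        4 * Dm * W ^ 2 + 4 * Dm * W ^ 2 + 4 * Dm * W ^ 2 := by
        refine (abs_add_le _ _).trans (add_le_add ?_ b22)
        refine (abs_add_le _ _).trans (add_le_add ?_ b21)
        refine (abs_add_le _ _).trans (add_le_add ?_ b20)
        refine (abs_add_le _ _).trans (add_le_add ?_ b12)
        refine (abs_add_le _ _).trans (add_le_add ?_ b11)
        refine (abs_add_le _ _).trans (add_le_add ?_ b10)
        refine (abs_add_le _ _).trans (add_le_add ?_ b02)
        exact (abs_add_le _ _).trans (add_le_add b00 b01)
    _ = 36 * Dm * W ^ 2 := by ring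

end RankOne

end Summit.QuantumFields.YangMills.Theorems.AllWindowsColdBoxBoxHighLine

end
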